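/-
Copyright (c) 2026 the pub-hodgecm-mathlib formalisation cell (harness21).  Prover seat hodgecm-mathlib-LH4-p06 (g7), req620 Track A «(D-RAM) FOUR-FRAME» squad, helper lane
on h413 = stmt-HodgeConjecture-24833 (count-neutral).  RamM-lane organ (R3′) «THE OC-WELD OF THE FRAME ON TYPE RamM» (LH4-p07 (g9) 14:07:57Z; dealer LH4-plan (g13)
WORD #109 (1)-alt): ★ p860838's reindex over LH4-p08 (g9)'s (R2-frame) weld of the frame.  2026-09-04.
-/
import Summits.HodgeConjecture.HodgeConjecture.Theorems.F0P3cDyRamToricCensusSumRamMWeldCutOfFrame  -- ★ (LH4-p08 (g9)): (R2-frame) `toricCensusSum_ramM_weld_cut_of_frame[_flip]`; brings (R1) ★ p860848 `tokens_inv_mul`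
import Summits.HodgeConjecture.HodgeConjecture.Theorems.F0P3cDyRamToricCensusSumRamMCutReindex     -- ★ p860643 (LH4-p07 (g9)): `cutOrderCounts_eq_cutCensusSum_of_cells_ramified`
import Summits.HodgeConjecture.HodgeConjecture.Theorems.F0P3cDyRamToricCensusSumCutReindex         -- ★ p859781 (LH4-p07 (g9)): `sub_eq_sum_ite_sub` (type-free)
import HarnessLib

/-!
# Crux `H413`, line LH4 «(D-RAM) FOUR-FRAME» — RamM lane, organ (R3′): «THE LEVEL-PIECE WELD OF THE FRAME IN ORDER-COUNT CURRENCY, TYPE RamM»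
# `ε·(cutOC_h(μ₁) − cutOC_{h′}(μ₁)) = W_RamM(m₁, jl₁, C)` from the FRAME LETTERS — both parity classes

Cell `hodgecm-mathlib` (D-0151), FLOOR 0, crux item H413 = `stmt-HodgeConjecture-24833`, route of record `HCCMUnconditional`; squad F0∕P3c∕LH4; lane
`--supports stmt-HodgeConjecture-24833 --as helper` (count-neutral; pays NO tier-0 row).  THEOREMS ONLY (no `def`, no instance, no notation, no `sorry`, default heartbeats).
★ p860838 (this seat, (R3)) welds the two literals' CUT ORDER COUNTS modulo the six per-cell letters; ★ LH4-p08 (g9)'s (R2-frame) `toricCensusSum_ramM_weld_cut_of_frame`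
discharges those letters from the RamM FRAME at the scaled multiplier `μ₁ = tc⁻¹(λ − u)` (tokens `(m₁, jl₁)`, (R1) ★ p860848).  THIS FILE is their composition — the ONE
organ per parity class that LH4-p07 (g9)'s socket `levelsCensusC` calls, exactly as ★ p860440 `levelsCensusB` calls ★ p860034 on type RamK:
* **`levelOrderCounts_ramM_weld_cut_of_frame`** (standard class, `eo` even) = (R2-frame)'s binders VERBATIM + the order-filtration marker `{lam′} (hiff : ∀ j, lam′ ∈ 𝒪_j ↔ j ≤ jl₁)`
  and the cell-depth letters `hRh ∕ hRh′` (★ p860643's phrasing) ⊢ `ε·((cutOC_h(μ₁) : ℕ) − (cutOC_{h′}(μ₁) : ℕ)) =` (R2-frame)'s value VERBATIM, where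
  `cutOC(μ₁) = Σ_{j ≤ jl₁} #levelSet(j, 0) + Σ_{b ∈ Icc 1 R} Σ_{j ≤ jl₁} [j + b ≤ C]·q^b·#levelSetDep(j, b; μ₁)`;
* **`levelOrderCounts_ramM_weld_cut_of_frame_flip`** (flipped class, `eo` odd) — the same over `toricCensusSum_ramM_weld_cut_of_frame_flip`.
Proof: (R1) `tokens_inv_mul` (μ₁'s tokens), ★ p860643 on both literals, `push_cast`, ★ `sub_eq_sum_ite_sub`, (R2-frame).
HONEST LABEL.  Count-neutral; one abstract dyadic field, no CM place, no law asserted; the four (C-5b) side letters remain HYPOTHESES (as in ★ (C) and (R2-frame));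
`HC_CM` is proved only modulo the 7 printed citations (2 remaining named inputs: hLiu418 = `stmt-HodgeConjecture-24832`, h413 = `stmt-HodgeConjecture-24833`) until rung 0 closes.

## References
* [Kottwitz1986BaseChangeUnits] R. E. Kottwitz, *Base change for unit elements of Hecke algebras*, Compositio Math. 60 (1986): §1 pp. 240–241.
* [Rogawski1990] J. D. Rogawski, *Automorphic Representations of Unitary Groups in Three Variables*, Ann. of Math. Stud. 123 (1990): §4.9 Prop. 4.9.1 (b) p. 55, Lemma 4.9.3 p. 56.
* [Flicker1998UnitaryFL] Y. Z. Flicker, *Elementary proof of the fundamental lemma for a unitary group*, Canad. J. Math. 50 (1998): Prop. 7 p. 84.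
* [Jacobowitz1962] R. Jacobowitz, *Hermitian forms over local fields*, Amer. J. Math. 84 (1962): §4.
* [Serre1979] J.-P. Serre, *Local Fields*, GTM 67 (1979): Ch. V §3 Prop. 5, Cor. 3.
-/

set_option autoImplicit false

namespace Summit.HodgeConjecture.HodgeConjecture.Cruxes.H413.F0P3cDyRamLevelOrderCountsRamMWeldCutOfFrame

open WithZero IsLocalRing Finset
open scoped Valued Classical
open Literature.NumberTheory.Automorphic.UnitaryThreeFourFrame (IsRamifiedQuadraticDatum)
open Summit.HodgeConjecture.HodgeConjecture.Cruxes.H413.F0P3cDyRamToricCensusDefs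
open Summit.HodgeConjecture.HodgeConjecture.Cruxes.H413.F0P3cDyRamToricLevelCensusRamM (tokens_inv_mul)
open Summit.HodgeConjecture.HodgeConjecture.Cruxes.H413.F0P3cDyRamToricCensusSumCutReindex (sub_eq_sum_ite_sub)
open Summit.HodgeConjecture.HodgeConjecture.Cruxes.H413.F0P3cDyRamToricCensusSumRamMCutReindex (cutOrderCounts_eq_cutCensusSum_of_cells_ramified)
open Summit.HodgeConjecture.HodgeConjecture.Cruxes.H413.F0P3cDyRamToricCensusSumRamMWeldCutOfFrame
  (toricCensusSum_ramM_weld_cut_of_frame toricCensusSum_ramM_weld_cut_of_frame_flip)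

/-! ## §1 Standard parity class (`eo` even) -/

/-- **(OC-weld-frame)-RamM, STANDARD CLASS.**  (R2-frame)'s binders VERBATIM + `{lam′} (hiff)` and the cell-depth letters `hRh`, `hRh′`: the two literals' CUT ORDER COUNTS
over the cells of `μ₁ = tc⁻¹(λ − u)` differ, after the sign `ε`, by (R2-frame)'s value.
[cite: Kottwitz1986BaseChangeUnits, §1 pp. 240–241] [cite: Rogawski1990, §4.9 Prop. 4.9.1 (b) p. 55, Lemma 4.9.3 p. 56] [cite: Flicker1998UnitaryFL, Prop. 7 p. 84] [cite: Jacobowitz1962, §4] [cite: Serre1979, Ch. V §3 Prop. 5, Cor. 3] -/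
theorem levelOrderCounts_ramM_weld_cut_of_frame
    {K : Type} [Field K] [Valued K ℤᵐ⁰] [CompleteSpace K] [IsDiscreteValuationRing 𝒪[K]] [Finite 𝓀[K]] {ρ Θ τ : K →+* K}
    (hρρ : ∀ x, ρ (ρ x) = x) (hvρ : ∀ x, Valued.v (ρ x) = Valued.v x)
    (hΘΘ : ∀ x, Θ (Θ x) = x) (hΘρ : ∀ x, Θ (ρ x) = ρ (Θ x)) (hvΘ : ∀ x, Valued.v (Θ x) = Valued.v x) (hτ : ∀ x, τ x = Θ (ρ x))
    (hΘres : ∀ x : K, Valued.v x ≤ 1 → Valued.v (x - Θ x) < 1)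
    {ϖM : K} (hϖM : Valued.v ϖM = exp (-1 : ℤ)) {dρ dΘ dτ t : ℕ}
    (hDρ : IsRamifiedQuadraticDatum ρ ϖM dρ t) (hDΘ : IsRamifiedQuadraticDatum Θ ϖM dΘ t) (hDτ : IsRamifiedQuadraticDatum τ ϖM dτ t)
    (hF4 : ∀ z : K, ρ z = z → Θ z = z → z ≠ 0 → ∃ n : ℤ, Valued.v z = exp (4 * n))
    (hFN : ∀ f : K, ρ f = f → Θ f = f → Valued.v f = 1 → ∃ z : K, z * Θ z = f)
    {c₀ : K} (hc₀ : Valued.v c₀ = 1) (hdich : ∀ u : K, Θ u = u → Valued.v u = 1 → (∃ z : K, z * Θ z = u) ∨ ∃ z : K, z * Θ z = c₀ * u)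
    {n₀ : K} (hΘn₀ : Θ n₀ = n₀) (hn₀1 : Valued.v n₀ = 1) (hn₀N : ¬ ∃ z : K, z * Θ z = n₀)
    {ϖE : K} (hϖE : Valued.v ϖE = exp (-2 : ℤ)) (hρϖ : ρ ϖE = ϖE)
    {q : ℕ} (hq : Nat.card 𝓀[K] = q) (hq2 : 2 ∣ q)
    {g s0 dK d' : ℕ} (hg2 : dΘ = 2 * g) (hs02 : dτ = 2 * s0) (hg1 : 1 ≤ g) (hs01 : 1 ≤ s0)
    (hdKv : Valued.v (ϖM * τ ϖM - ρ (ϖM * τ ϖM)) = exp (-(2 * (dK : ℤ)))) (hdK2 : 2 * dK = dρ + 2 * g)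
    (hd'v : Valued.v (ϖM * Θ ϖM - ρ (ϖM * Θ ϖM)) = exp (-(2 * (d' : ℤ)))) (hd'2 : 2 * d' = dρ + dτ)
    {h h' : K} (hΘh : Θ h = h) (hh : h ≠ 0) (hhyper : ∃ x : K, x ≠ 0 ∧ h * Θ x * x + ρ (h * Θ x * x) = 0)
    (hΘh' : Θ h' = h') (hh' : h' ≠ 0) (haniso : ¬ ∃ x : K, x ≠ 0 ∧ h' * Θ x * x + ρ (h' * Θ x * x) = 0)
    {vh vh' e e' : ℤ} (hvh : Valued.v h = exp (-vh)) (hvh' : Valued.v h' = exp (-vh')) (he : vh + dρ = 2 * e) (he' : vh' + dρ = 2 * e')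
    {lam u : K} (hlamΘ : lam * Θ lam = 1) (hu : ρ u = u) (hu1' : u * Θ u = 1)
    {m jl : ℕ} (hμ : Valued.v (lam - u) = Valued.v ϖE ^ m) (hjl : Valued.v ((lam - u) - ρ (lam - u)) = Valued.v (ϖE ^ jl * (ϖM - ρ ϖM)))
    {tc : K} (hρt : ρ tc = tc) {eo : ℕ} (hte : Valued.v tc = Valued.v ϖE ^ eo) (heo : eo % 2 = 0) {m₁ jl₁ : ℕ} (hme : m₁ + eo = m) (hjle' : jl₁ + eo = jl)
    (hjlg : jl % 2 = g % 2) (hmjl : m ≤ jl) (hdeep : 3 * (g + s0) ≤ m)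
    (hparW : m % 2 = (g + s0) % 2 ∨ jl + 2 ≤ m + 2 * g + s0)
    (hreg : (m + s0 ≤ jl ∧ (m + s0) % 2 = jl % 2) ∨ jl + 1 = m + s0)
    (ε : ℚ) (hεQ : ε = 1 ∨ (ε = -1 ∧ jl + 2 ≤ m + 2 * g + s0))
    -- (C-5b) Σ3 the four SIDE LETTERS (F0P3a-p01 (g34)): regime A (`m + s0 ≤ jl`) TP∕TE, regime B (`jl + 1 = m + s0`) the η-bits
    (hST : m + s0 ≤ jl → (∃ ω : K, Valued.v ω = 1 ∧
      Valued.v (ρ (lam - u) / (lam - u) * (ρ (ω * Θ ω) / (ω * Θ ω)) - 1) ≤ exp (-(2 * ((s0 : ℤ) + 2 * g - 1) + dρ))) → ε = 1)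
    (hSE : m + s0 ≤ jl → (∃ ω : K, Valued.v ω = 1 ∧
      Valued.v (ρ (lam - u) / (lam - u) * (ρ n₀ / n₀) * (ρ (ω * Θ ω) / (ω * Θ ω)) - 1) ≤ exp (-(2 * ((s0 : ℤ) + 2 * g - 1) + dρ))) → ε = -1)
    (hSP : jl + 1 = m + s0 → (∃ ω₁ : Kˣ, Valued.v (ω₁ : K) = 1 ∧
      Valued.v (1 + ρ h / h * (ρ (ϖM ^ ((m : ℤ) - jl - e) * Θ (ϖM ^ ((m : ℤ) - jl - e))) / (ϖM ^ ((m : ℤ) - jl - e) * Θ (ϖM ^ ((m : ℤ) - jl - e)))) /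
        (ρ (lam - u) / (lam - u)) * (ρ ((ω₁ : K) * Θ ω₁) / ((ω₁ : K) * Θ ω₁))) ≤ exp (-(2 * ((s0 : ℤ) + 2 * g - 1) + dρ))) → ε = 1)
    (hSM : jl + 1 = m + s0 → (∃ ω₁ : Kˣ, Valued.v (ω₁ : K) = 1 ∧
      Valued.v (1 + ρ h' / h' * (ρ (ϖM ^ ((m : ℤ) - jl - e') * Θ (ϖM ^ ((m : ℤ) - jl - e'))) / (ϖM ^ ((m : ℤ) - jl - e') * Θ (ϖM ^ ((m : ℤ) - jl - e')))) /
        (ρ (lam - u) / (lam - u)) * (ρ ((ω₁ : K) * Θ ω₁) / ((ω₁ : K) * Θ ω₁))) ≤ exp (-(2 * ((s0 : ℤ) + 2 * g - 1) + dρ))) → ε = -1)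
        (hed : eo ≤ g + s0) (hjlS₁ : 3 * g + 2 * s0 ≤ jl₁ + 2 + 2 * ((g + s0) % 2)) (C : ℕ) (hC : jl₁ ≤ C) (hCe : C + (g + s0) ≤ m₁ + jl₁ + 1)
    {lam' : K} (hiff : ∀ j, IsOrd ρ ϖM (ϖE ^ j) lam' ↔ j ≤ jl₁) {R R' : ℕ}
    (hRh : ∀ j b, 1 ≤ b → IsOrd ρ ϖM (ϖE ^ j) lam' → (levelSetDep ρ Θ ϖM ϖE h j b (tc⁻¹ * (lam - u))).Nonempty → b ≤ R)
    (hRh' : ∀ j b, 1 ≤ b → IsOrd ρ ϖM (ϖE ^ j) lam' → (levelSetDep ρ Θ ϖM ϖE h' j b (tc⁻¹ * (lam - u))).Nonempty → b ≤ R') :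
    ε * (((((∑ j ∈ range (jl₁ + 1), (levelSet ρ Θ ϖM ϖE h j 0).ncard) +
            ∑ b ∈ Icc 1 R, ∑ j ∈ range (jl₁ + 1), (if j + b ≤ C then q ^ b * (levelSetDep ρ Θ ϖM ϖE h j b (tc⁻¹ * (lam - u))).ncard else 0) : ℕ) : ℚ)) -
          ((((∑ j ∈ range (jl₁ + 1), (levelSet ρ Θ ϖM ϖE h' j 0).ncard) +
            ∑ b ∈ Icc 1 R', ∑ j ∈ range (jl₁ + 1), (if j + b ≤ C then q ^ b * (levelSetDep ρ Θ ϖM ϖE h' j b (tc⁻¹ * (lam - u))).ncard else 0) : ℕ) : ℚ))) =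
      (q : ℚ) ^ m₁ * (2 * ∑ i ∈ range ((jl₁ - g) / 2 + 1), (q : ℚ) ^ i - 2 * ∑ i ∈ range (g + s0 - (g + s0) % 2), (q : ℚ) ^ i) -
        2 * ∑ a ∈ (range (jl₁ + 2)).filter (fun a => a ≤ m₁ ∧ C + m₁ < jl₁ + 2 * a ∧ 2 * m₁ + 2 * g + s0 < jl₁ + 2 * a + 2 ∧ 2 * a + (g + s0) ≤ 2 * m₁ + 1),
          (q : ℚ) ^ (a + (jl₁ + s0) / 2) := by
  classical
  -- the scaled multiplier's RamM tokens ((R1) ★ p860848 `tokens_inv_mul`)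
  obtain ⟨hμ₁, hjl₁, -⟩ := tokens_inv_mul hϖE hμ hjl hρt hte hme hjle'
  -- ★ p860643: both literals re-indexed into the cut weld's row∕column shape
  rw [cutOrderCounts_eq_cutCensusSum_of_cells_ramified hDρ hΘΘ hΘρ hvΘ hρϖ hϖE hh hμ₁ hjl₁ q hiff hC hRh,
    cutOrderCounts_eq_cutCensusSum_of_cells_ramified hDρ hΘΘ hΘρ hvΘ hρϖ hϖE hh' hμ₁ hjl₁ q hiff hC hRh']
  push_cast
  rw [sub_eq_sum_ite_sub]
  exact toricCensusSum_ramM_weld_cut_of_frame hρρ hvρ hΘΘ hΘρ hvΘ hτ hΘres hϖM hDρ hDΘ hDτ hF4 hFN hc₀ hdich hΘn₀ hn₀1 hn₀N hϖE hρϖ hq hq2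
    hg2 hs02 hg1 hs01 hdKv hdK2 hd'v hd'2 hΘh hh hhyper hΘh' hh' haniso hvh hvh' he he' hlamΘ hu hu1' hμ hjl hρt hte heo hme hjle' hjlg hmjl hdeep hparW hreg
    ε hεQ hST hSE hSP hSM hed hjlS₁ C hC hCe

/-! ## §2 Flipped parity class (`eo` odd) -/

/-- **(OC-weld-frame)-RamM♭, FLIPPED CLASS.**  The same over (R2-frame)'s `toricCensusSum_ramM_weld_cut_of_frame_flip` (its binders and value VERBATIM).
[cite: Kottwitz1986BaseChangeUnits, §1 pp. 240–241] [cite: Rogawski1990, §4.9 Prop. 4.9.1 (b) p. 55, Lemma 4.9.3 p. 56] [cite: Flicker1998UnitaryFL, Prop. 7 p. 84] [cite: Jacobowitz1962, §4] [cite: Serre1979, Ch. V §3 Prop. 5, Cor. 3] -/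
theorem levelOrderCounts_ramM_weld_cut_of_frame_flip
    {K : Type} [Field K] [Valued K ℤᵐ⁰] [CompleteSpace K] [IsDiscreteValuationRing 𝒪[K]] [Finite 𝓀[K]] {ρ Θ τ : K →+* K}
    (hρρ : ∀ x, ρ (ρ x) = x) (hvρ : ∀ x, Valued.v (ρ x) = Valued.v x)
    (hΘΘ : ∀ x, Θ (Θ x) = x) (hΘρ : ∀ x, Θ (ρ x) = ρ (Θ x)) (hvΘ : ∀ x, Valued.v (Θ x) = Valued.v x) (hτ : ∀ x, τ x = Θ (ρ x))
    (hΘres : ∀ x : K, Valued.v x ≤ 1 → Valued.v (x - Θ x) < 1)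
    {ϖM : K} (hϖM : Valued.v ϖM = exp (-1 : ℤ)) {dρ dΘ dτ t : ℕ}
    (hDρ : IsRamifiedQuadraticDatum ρ ϖM dρ t) (hDΘ : IsRamifiedQuadraticDatum Θ ϖM dΘ t) (hDτ : IsRamifiedQuadraticDatum τ ϖM dτ t)
    (hF4 : ∀ z : K, ρ z = z → Θ z = z → z ≠ 0 → ∃ n : ℤ, Valued.v z = exp (4 * n))
    (hFN : ∀ f : K, ρ f = f → Θ f = f → Valued.v f = 1 → ∃ z : K, z * Θ z = f)
    {c₀ : K} (hc₀ : Valued.v c₀ = 1) (hdich : ∀ u : K, Θ u = u → Valued.v u = 1 → (∃ z : K, z * Θ z = u) ∨ ∃ z : K, z * Θ z = c₀ * u)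
    {n₀ : K} (hΘn₀ : Θ n₀ = n₀) (hn₀1 : Valued.v n₀ = 1) (hn₀N : ¬ ∃ z : K, z * Θ z = n₀)
    {ϖE : K} (hϖE : Valued.v ϖE = exp (-2 : ℤ)) (hρϖ : ρ ϖE = ϖE)
    {q : ℕ} (hq : Nat.card 𝓀[K] = q) (hq2 : 2 ∣ q)
    {g s0 dK d' : ℕ} (hg2 : dΘ = 2 * g) (hs02 : dτ = 2 * s0) (hg1 : 1 ≤ g) (hs01 : 1 ≤ s0)
    (hdKv : Valued.v (ϖM * τ ϖM - ρ (ϖM * τ ϖM)) = exp (-(2 * (dK : ℤ)))) (hdK2 : 2 * dK = dρ + 2 * g)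
    (hd'v : Valued.v (ϖM * Θ ϖM - ρ (ϖM * Θ ϖM)) = exp (-(2 * (d' : ℤ)))) (hd'2 : 2 * d' = dρ + dτ)
    {h h' : K} (hΘh : Θ h = h) (hh : h ≠ 0) (hhyper : ∃ x : K, x ≠ 0 ∧ h * Θ x * x + ρ (h * Θ x * x) = 0)
    (hΘh' : Θ h' = h') (hh' : h' ≠ 0) (haniso : ¬ ∃ x : K, x ≠ 0 ∧ h' * Θ x * x + ρ (h' * Θ x * x) = 0)
    {vh vh' e e' : ℤ} (hvh : Valued.v h = exp (-vh)) (hvh' : Valued.v h' = exp (-vh')) (he : vh + dρ = 2 * e) (he' : vh' + dρ = 2 * e')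
    {lam u : K} (hlamΘ : lam * Θ lam = 1) (hu : ρ u = u) (hu1' : u * Θ u = 1)
    {m jl : ℕ} (hμ : Valued.v (lam - u) = Valued.v ϖE ^ m) (hjl : Valued.v ((lam - u) - ρ (lam - u)) = Valued.v (ϖE ^ jl * (ϖM - ρ ϖM)))
    {tc : K} (hρt : ρ tc = tc) {eo : ℕ} (hte : Valued.v tc = Valued.v ϖE ^ eo) (heo : eo % 2 = 1) {m₁ jl₁ : ℕ} (hme : m₁ + eo = m) (hjle' : jl₁ + eo = jl)
    (hjlg : jl % 2 = g % 2) (hmjl : m ≤ jl) (hdeep : 3 * (g + s0) ≤ m)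
    (hparW : m % 2 = (g + s0) % 2 ∨ jl + 2 ≤ m + 2 * g + s0)
    (hreg : (m + s0 ≤ jl ∧ (m + s0) % 2 = jl % 2) ∨ jl + 1 = m + s0)
    (ε : ℚ) (hεQ : ε = 1 ∨ (ε = -1 ∧ jl + 2 ≤ m + 2 * g + s0))
    -- (C-5b) Σ3 the four SIDE LETTERS (F0P3a-p01 (g34)): regime A (`m + s0 ≤ jl`) TP∕TE, regime B (`jl + 1 = m + s0`) the η-bits
    (hST : m + s0 ≤ jl → (∃ ω : K, Valued.v ω = 1 ∧
      Valued.v (ρ (lam - u) / (lam - u) * (ρ (ω * Θ ω) / (ω * Θ ω)) - 1) ≤ exp (-(2 * ((s0 : ℤ) + 2 * g - 1) + dρ))) → ε = 1)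
    (hSE : m + s0 ≤ jl → (∃ ω : K, Valued.v ω = 1 ∧
      Valued.v (ρ (lam - u) / (lam - u) * (ρ n₀ / n₀) * (ρ (ω * Θ ω) / (ω * Θ ω)) - 1) ≤ exp (-(2 * ((s0 : ℤ) + 2 * g - 1) + dρ))) → ε = -1)
    (hSP : jl + 1 = m + s0 → (∃ ω₁ : Kˣ, Valued.v (ω₁ : K) = 1 ∧
      Valued.v (1 + ρ h / h * (ρ (ϖM ^ ((m : ℤ) - jl - e) * Θ (ϖM ^ ((m : ℤ) - jl - e))) / (ϖM ^ ((m : ℤ) - jl - e) * Θ (ϖM ^ ((m : ℤ) - jl - e)))) /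
        (ρ (lam - u) / (lam - u)) * (ρ ((ω₁ : K) * Θ ω₁) / ((ω₁ : K) * Θ ω₁))) ≤ exp (-(2 * ((s0 : ℤ) + 2 * g - 1) + dρ))) → ε = 1)
    (hSM : jl + 1 = m + s0 → (∃ ω₁ : Kˣ, Valued.v (ω₁ : K) = 1 ∧
      Valued.v (1 + ρ h' / h' * (ρ (ϖM ^ ((m : ℤ) - jl - e') * Θ (ϖM ^ ((m : ℤ) - jl - e'))) / (ϖM ^ ((m : ℤ) - jl - e') * Θ (ϖM ^ ((m : ℤ) - jl - e')))) /
        (ρ (lam - u) / (lam - u)) * (ρ ((ω₁ : K) * Θ ω₁) / ((ω₁ : K) * Θ ω₁))) ≤ exp (-(2 * ((s0 : ℤ) + 2 * g - 1) + dρ))) → ε = -1)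
        (hed : eo ≤ g + s0) (hjlS₁ : 3 * g + 2 * s0 ≤ jl₁ + 3) (C : ℕ) (hC : jl₁ ≤ C) (hCe : C + (g + s0) ≤ m₁ + jl₁ + 1)
    {lam' : K} (hiff : ∀ j, IsOrd ρ ϖM (ϖE ^ j) lam' ↔ j ≤ jl₁) {R R' : ℕ}
    (hRh : ∀ j b, 1 ≤ b → IsOrd ρ ϖM (ϖE ^ j) lam' → (levelSetDep ρ Θ ϖM ϖE h j b (tc⁻¹ * (lam - u))).Nonempty → b ≤ R)
    (hRh' : ∀ j b, 1 ≤ b → IsOrd ρ ϖM (ϖE ^ j) lam' → (levelSetDep ρ Θ ϖM ϖE h' j b (tc⁻¹ * (lam - u))).Nonempty → b ≤ R') :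
    ε * (((((∑ j ∈ range (jl₁ + 1), (levelSet ρ Θ ϖM ϖE h j 0).ncard) +
            ∑ b ∈ Icc 1 R, ∑ j ∈ range (jl₁ + 1), (if j + b ≤ C then q ^ b * (levelSetDep ρ Θ ϖM ϖE h j b (tc⁻¹ * (lam - u))).ncard else 0) : ℕ) : ℚ)) -
          ((((∑ j ∈ range (jl₁ + 1), (levelSet ρ Θ ϖM ϖE h' j 0).ncard) +
            ∑ b ∈ Icc 1 R', ∑ j ∈ range (jl₁ + 1), (if j + b ≤ C then q ^ b * (levelSetDep ρ Θ ϖM ϖE h' j b (tc⁻¹ * (lam - u))).ncard else 0) : ℕ) : ℚ))) =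
      (q : ℚ) ^ m₁ * (2 * ∑ i ∈ range ((jl₁ + 1 - g) / 2 + (g + s0) % 2), (q : ℚ) ^ i - 2 * ∑ i ∈ range (g + s0 - 1 + (g + s0) % 2), (q : ℚ) ^ i) -
        2 * ∑ a ∈ (range (jl₁ + 2)).filter (fun a => a ≤ m₁ ∧ C + m₁ < jl₁ + 2 * a ∧ 2 * m₁ + 2 * g + s0 < jl₁ + 2 * a + 2 ∧ 2 * a + (g + s0) ≤ 2 * m₁ + 1),
          (q : ℚ) ^ (a + (jl₁ + s0) / 2) := by
  classical
  -- the scaled multiplier's RamM tokens ((R1) ★ p860848 `tokens_inv_mul`)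
  obtain ⟨hμ₁, hjl₁, -⟩ := tokens_inv_mul hϖE hμ hjl hρt hte hme hjle'
  -- ★ p860643: both literals re-indexed into the cut weld's row∕column shape
  rw [cutOrderCounts_eq_cutCensusSum_of_cells_ramified hDρ hΘΘ hΘρ hvΘ hρϖ hϖE hh hμ₁ hjl₁ q hiff hC hRh,
    cutOrderCounts_eq_cutCensusSum_of_cells_ramified hDρ hΘΘ hΘρ hvΘ hρϖ hϖE hh' hμ₁ hjl₁ q hiff hC hRh']
  push_cast
  rw [sub_eq_sum_ite_sub]
  exact toricCensusSum_ramM_weld_cut_of_frame_flip hρρ hvρ hΘΘ hΘρ hvΘ hτ hΘres hϖM hDρ hDΘ hDτ hF4 hFN hc₀ hdich hΘn₀ hn₀1 hn₀N hϖE hρϖ hq hq2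
    hg2 hs02 hg1 hs01 hdKv hdK2 hd'v hd'2 hΘh hh hhyper hΘh' hh' haniso hvh hvh' he he' hlamΘ hu hu1' hμ hjl hρt hte heo hme hjle' hjlg hmjl hdeep hparW hreg
    ε hεQ hST hSE hSP hSM hed hjlS₁ C hC hCe

end Summit.HodgeConjecture.HodgeConjecture.Cruxes.H413.F0P3cDyRamLevelOrderCountsRamMWeldCutOfFrame
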